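import Literature.AlgebraicGeometry.Motives.HodgeStructureEndActionCentralBlocks
import Literature.AlgebraicGeometry.Motives.HodgeStructureLefschetzGroupUnitarySplitting
import Literature.AlgebraicGeometry.Motives.HodgeStructurePolarizationAdjointPoints
import HarnessLib

/-!
# Milne 1999 §2 on points: the Rosati involution `†` of `C(H)(K)` acts on the blocks by TRANSPOSITION across the
# perfect pairing `Q_K : V_{K,χ} × V_{K,χ∘σ} → K` — "`(α, β)† = (βᵗʳ, αᵗʳ)`" (type IV, `Ē = M_d × M_d`), "the involution
# sends an element of `Cᵢ` to its adjoint with respect to `φᵢ`" (type I)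

[topic AlgebraicGeometry/Motives]

Layer `Literature/AlgebraicGeometry/Motives`, lane `lit-hodgefound` (Track 2 foundations library; seat `lit-hodgefound-p34`,
generation 22, self-proposed row g22-#5). Milne's `C(A)` carries the involution `†` of an(y) ample divisor (§1 p. 643: "`C(A)`
is a `k`-algebra stable under the involution `†`"), and in the block computations of §2 the involution is read off block by
block: for type I "the involution sends an element of `Cᵢ` to its adjoint with respect to `φᵢ`" (p. 648), for type IV the model
algebra `Ē = M_d(k^al) × M_d(k^al)` acting on `V̄ = V₁ ⊕ V₂`, `V₂ = V₁^∨`, carries "`(α, β)† = (βᵗʳ, αᵗʳ)`" (p. 651 L5–L8) —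
the involution SWAPS the two blocks of a conjugate pair and is the transpose with respect to the duality
`φ₀ : V₁ × V₂ → k^al`. This file is that statement on `K`-points, on the abstract polarized `ℚ`-Hodge structure with a number
field `F` acting through `A : EndAction H F`, for the involution `β ↦ β†` of `End_K(K ⊗ V)` defined by `Q_K`
(`Motives/HodgeStructurePolarizationAdjointPoints.Polarization.adjointBaseChange`) and the PERFECT pairing
`Q_K : V_{K,τₛ} × V_{K,τₛ∘σ} → K` of the seat's `Motives/HodgeStructureLefschetzGroupUnitarySplitting`
(`Polarization.isPerfPair_baseChange_form_eigenspaceBaseChange`, Milne's Remark 2.2 "`V₂ = V₁^∨`"), with the restricted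
operators `a_K|V_{K,χ}` of `Motives/HodgeStructureEndActionCentralBlocks`. Definitions WITH BODIES (`pairingTranspose` —
the transpose of an endomorphism across a perfect pairing, generic; `Polarization.blockPairing`; `Polarization.blockTranspose`;
`EndAction.restrictBlock`) and theorems; no named fact (net debt `0`).

## The source, verbatim

J. S. Milne, *Lefschetz classes on abelian varieties*, Duke Math. J. **96** (1999) 639–675 [Milne1999LefschetzClasses]
(held `paper:doi-10-1215-s0012-7094-99-09620-5`; Duke page = folio + 638):
* (§1 p. 642 L64–L70) "we let `β†` denote the adjoint with respect to `e_D` of a `k`-linear endomorphism `β` of `V(A)`: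
  `e_D(βx, y) = e_D(x, β†y)`, all `x, y ∈ V(A)`. Then `β ↦ β†` is an involution of the `k`-algebra `End_k(V(A))` whose
  restriction to `End⁰(A)` is the Rosati involution"; (p. 643 L5–L6) "`C(A)` is a `k`-algebra stable under the involution `†`
  defined by an ample divisor `D`, and the restriction of `†` to `C(A)` is independent of the choice of `D`."
* (type I, p. 648 L48–L52) "`C(A) = C₁ × ⋯ × C_t`, `Cᵢ = End_{Fᵢ}(Vᵢ) ≈ M_{2g/f}(Fᵢ)` and the involution sends an element of
  `Cᵢ` to its adjoint with respect to `φᵢ`."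
* (type IV, p. 650 L70 – p. 651 L21) "Let `V₂ = V₁^∨`. It has a natural structure of a right `M_d(k^al)`-module, which we turn
  into a left module structure by using the involution `α ↦ αᵗʳ`. The bilinear form `(x₁, x₂) ↦ φ₀(x₁, x₂) = x₂(x₁) :
  V₁ × V₂ → k` has the property that `φ₀(αx₁, x₂) = φ₀(x₁, αᵗʳx₂)`. Set: `V̄ = V₁ ⊕ V₂`, `Ē = M_d(k^al) × M_d(k^al)`,
  `(α, β)† = (βᵗʳ, αᵗʳ)` […] Then `†` is an involution on `Ē` […] and `φ̄(αx̄, ȳ) = φ̄(x̄, α†ȳ)`, all `α ∈ Ē`, `x̄, ȳ ∈ V̄`."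

DICTIONARY. For `c ∈ End_K(K ⊗ V)` commuting with `E_φ ⊗ K` (`hc`; in particular with `ι(F) ⊗ K`), `c` and `c†` preserve
every block (`c†` commutes with `E_φ ⊗ K` too, since `E_φ† = E_φ`: the tree's
`Polarization.forall_baseChange_comp_adjointBaseChange_of_forall_comm`); the block of `c†` on `V_{K,τₛ∘σ}` is the TRANSPOSE of
the block of `c` on `V_{K,τₛ}` across `Q_K : V_{K,τₛ} × V_{K,τₛ∘σ} → K` — Milne's `φ₀` (type IV; for a `σ`-fixed embedding
the two blocks coincide and this is "its adjoint with respect to `φᵢ`").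

## What is PROVED

* §0 (generic, for a perfect pairing `p : M × N → R`) DEF **`pairingTranspose p hp f`** (`fᵀ ∈ End N` for `f ∈ End M`,
  `e⁻¹ ∘ f^∨ ∘ e` with `e : N ≃ M^∨`), `apply_pairingTranspose` (`p(x, fᵀy) = p(fx, y)`), `pairingTranspose_unique`,
  `pairingTranspose_mul` (anti-multiplicative), `_one`, `_add`, `_smul`, `_zero`, `pairingTranspose_flip_pairingTranspose`
  (`(fᵀ)ᵀ = f` across the flipped pairing).
* §1 DEF `Polarization.blockPairing K A χ χ'` (`Q_K|V_{K,χ} × V_{K,χ'}`, `_apply`), `Polarization.isPerfPair_blockPairing` (F2's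
  perfect pairing for `χ' = χ ∘ σ`), DEF **`Polarization.blockTranspose … s : End_K(V_{K,τₛ}) → End_K(V_{K,τₛ∘σ})`** (`f ↦ fᵀ`
  across `Q_K`; `baseChange_form_apply_blockTranspose`, `blockTranspose_unique`, `_mul`, `_one`, `_injective`),
  `EndAction.apply_mem_eigenspaceBaseChange_of_forall_comm`, DEF `EndAction.restrictBlock` (the block `c|V_{K,χ}` of a `c`
  commuting with `E_φ ⊗ K`; `coe_restrictBlock_apply`), `EndAction.restrictBlock_mem_centralizer_blockOp` (`c|V_{K,χ} ∈ C_χ`).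
* §2 **`Polarization.restrictBlock_adjointBaseChange_eq_blockTranspose`**: for `c` commuting with `E_φ ⊗ K`,
  `c†|V_{K,τₛ∘σ} = (c|V_{K,τₛ})ᵀ` ("`(α, β)† = (βᵗʳ, αᵗʳ)`"); **`EndAction.blockTranspose_blockOp`**:
  `(a_K|V_{K,τₛ})ᵀ = (a†)_K|V_{K,τₛ∘σ}` (`a ∈ E_φ`, `a† ∈ E_φ`); **`EndAction.blockTranspose_mem_centralizer_blockOp`**: the
  transpose maps the commutant `C_{τₛ}` of `E_φ|V_{K,τₛ}` into `C_{τₛ∘σ}` (= `EndAction.blockCommutant` of the lane's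
  `Motives/HodgeStructureEndAlgCentralizerBlocks`, unfolded), i.e. `†` induces `C_{τₛ} → C_{τₛ∘σ}` anti-multiplicatively;
  `Polarization.restrictBlock_adjointBaseChange_mem_and_eq` (assembled for `c ∈ C(H)(K)`).

NOT here (honest): the matrix form `βᵗʳ` (it needs COMPATIBLE splittings `ρ_{sσ}(M) = (ρₛ(Mᵗʳ))ᵀ` of the two blocks — Milne's
"compatible isomorphisms `E_σ → Ē`", constructible from this file's `blockTranspose_blockOp` but not done); the packaging of
`†` as an algebra anti-automorphism of `∏ₜ C_{τₜ}`; positivity of the Rosati involution. HC is NOT proved; nothing here claims a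
case of the Hodge conjecture.

## References

* [Milne1999LefschetzClasses] J. S. Milne, *Lefschetz classes on abelian varieties*, Duke Math. J. 96 (1999) 639–675 — §1
  pp. 642–643 (the involution `†`, `C(A)` is `†`-stable), §2 Remark 2.2 (p. 647), p. 648 (type I), pp. 650–651 (type IV, `Ē`, `φ₀`).
* [Deligne1982HodgeCycles] P. Deligne, *Hodge cycles on abelian varieties*, LNM 900 (1982) — §4 (the decomposition along the
  action of a CM field and its pairing under a polarization, Lemma 4.6).
-/

noncomputable section

open scoped TensorProduct
open Function Module

namespace Literature.AlgebraicGeometry.Motives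

/-! ## §0 The transpose of an endomorphism across a perfect pairing -/

section PairingTranspose

variable {R : Type*} [CommRing R] {M : Type*} {N : Type*} [AddCommGroup M] [Module R M] [AddCommGroup N] [Module R N]
  (p : M →ₗ[R] N →ₗ[R] R) (hp : p.IsPerfPair)

/-- **The transpose `fᵀ ∈ End(N)` of `f ∈ End(M)` across a perfect pairing `p : M × N → R`**: `e⁻¹ ∘ f^∨ ∘ e` for the duality
`e : N ≃ M^∨`, `y ↦ p(·, y)` — Milne's `α ↦ αᵗʳ` on `V₂ = V₁^∨` ("`φ₀(αx₁, x₂) = φ₀(x₁, αᵗʳx₂)`").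
[cite: Milne1999LefschetzClasses, §2 p. 650 L70–L74 ("V₂ = V₁^∨ … φ₀(αx₁, x₂) = φ₀(x₁, αᵗʳ x₂)")]
-- TODO(move): generic linear algebra (`LinearAlgebra/PerfectPairing`). -/
def pairingTranspose (f : Module.End R M) : Module.End R N :=
  haveI := hp
  (p.flip.toPerfPair.symm : Module.Dual R M →ₗ[R] N) ∘ₗ (f.dualMap ∘ₗ (p.flip.toPerfPair : N →ₗ[R] Module.Dual R M))

/-- **`p(x, fᵀ y) = p(f x, y)`.** [cite: Milne1999LefschetzClasses, §2 p. 650 L74 ("φ₀(αx₁, x₂) = φ₀(x₁, αᵗʳ x₂)")] -/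
theorem apply_pairingTranspose (f : Module.End R M) (x : M) (y : N) : p x (pairingTranspose p hp f y) = p (f x) y := by
  haveI := hp
  have h : p x (pairingTranspose p hp f y) = p.flip (p.flip.toPerfPair.symm (f.dualMap (p.flip.toPerfPair y))) x := rfl
  rw [h, LinearMap.apply_symm_toPerfPair_self, LinearMap.dualMap_apply, LinearMap.toPerfPair_apply, LinearMap.flip_apply]

/-- **Uniqueness**: `g = fᵀ` as soon as `p(x, g y) = p(f x, y)` for all `x, y`. [cite: Milne1999LefschetzClasses, §2 p. 650 L74] -/
theorem pairingTranspose_unique {f : Module.End R M} {g : Module.End R N} (h : ∀ x y, p x (g y) = p (f x) y) :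
    g = pairingTranspose p hp f := by
  refine LinearMap.ext fun y => (LinearMap.IsPerfPair.bijective_right p).injective (LinearMap.ext fun x => ?_)
  rw [LinearMap.flip_apply, LinearMap.flip_apply, h, apply_pairingTranspose]

/-- `1ᵀ = 1`. [cite: Milne1999LefschetzClasses, §2 p. 651 L5–L8 ("† is an involution on Ē")] -/
theorem pairingTranspose_one : pairingTranspose p hp 1 = 1 :=
  (pairingTranspose_unique p hp fun _ _ => rfl).symm

/-- **`(f g)ᵀ = gᵀ fᵀ`** (anti-multiplicative). [cite: Milne1999LefschetzClasses, §2 p. 651 L5–L8 ("(α, β)† = (βᵗʳ, αᵗʳ) … † is an involution on Ē")] -/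
theorem pairingTranspose_mul (f g : Module.End R M) :
    pairingTranspose p hp (f * g) = pairingTranspose p hp g * pairingTranspose p hp f :=
  (pairingTranspose_unique p hp fun x y => by
    rw [Module.End.mul_apply, apply_pairingTranspose, apply_pairingTranspose, Module.End.mul_apply]).symm

/-- `0ᵀ = 0`. [cite: Milne1999LefschetzClasses, §2 p. 650 L74] -/
theorem pairingTranspose_zero : pairingTranspose p hp 0 = 0 :=
  (pairingTranspose_unique p hp fun x y => by
    rw [LinearMap.zero_apply, map_zero, LinearMap.zero_apply, map_zero, LinearMap.zero_apply]).symm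

/-- `(f + g)ᵀ = fᵀ + gᵀ`. [cite: Milne1999LefschetzClasses, §2 p. 650 L74] -/
theorem pairingTranspose_add (f g : Module.End R M) :
    pairingTranspose p hp (f + g) = pairingTranspose p hp f + pairingTranspose p hp g :=
  (pairingTranspose_unique p hp fun x y => by
    rw [LinearMap.add_apply, map_add, apply_pairingTranspose, apply_pairingTranspose, LinearMap.add_apply, map_add,
      LinearMap.add_apply]).symm

/-- `(c f)ᵀ = c fᵀ`. [cite: Milne1999LefschetzClasses, §2 p. 650 L74] -/
theorem pairingTranspose_smul (c : R) (f : Module.End R M) :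
    pairingTranspose p hp (c • f) = c • pairingTranspose p hp f :=
  (pairingTranspose_unique p hp fun x y => by
    rw [LinearMap.smul_apply, map_smul, apply_pairingTranspose, LinearMap.smul_apply, LinearMap.map_smul₂]).symm

/-- **`(fᵀ)ᵀ = f`** (transposing back across the flipped pairing): "`†` is an involution".
[cite: Milne1999LefschetzClasses, §2 p. 651 L5–L8 ("† is an involution on Ē")] -/
theorem pairingTranspose_flip_pairingTranspose (f : Module.End R M) :
    pairingTranspose p.flip hp.flip (pairingTranspose p hp f) = f :=
  (pairingTranspose_unique p.flip hp.flip fun y x => by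
    rw [LinearMap.flip_apply, LinearMap.flip_apply, apply_pairingTranspose]).symm

/-- The transpose is injective. [cite: Milne1999LefschetzClasses, §2 p. 651 L5–L8] -/
theorem pairingTranspose_injective : Injective (pairingTranspose p hp) := fun f g h => by
  rw [← pairingTranspose_flip_pairingTranspose p hp f, h, pairingTranspose_flip_pairingTranspose]

end PairingTranspose

namespace HodgeStructure

universe u uK

variable {V : Type u} [AddCommGroup V] [Module ℚ V] {n : ℤ} {H : HodgeStructure V n}
variable {F : Type*} [Field F] [NumberField F]
variable (K : Type uK) [Field K] [Algebra ℚ K] (A : EndAction H F) {S : Type*} (τ : S → (F →ₐ[ℚ] K))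
variable (Q : Polarization H) (σ : F ≃ₐ[ℚ] F)

/-! ## §1 The block pairings `Q_K : V_{K,χ} × V_{K,χ'} → K` and the blocks of an operator commuting with `E_φ ⊗ K` -/

/-- **`Q_K` restricted to a pair of blocks**, `Q_K|V_{K,χ} × V_{K,χ'}` (Milne's `φ₀ : V₁ × V₂ → k^al` for `χ' = χ ∘ σ`).
[cite: Milne1999LefschetzClasses, §2 Remark 2.2 (p. 647 L66–L69, "a nondegenerate Ω-bilinear form φ₁ : V₁ × V₂ → Ω") and p. 650 L72–L74] -/
def Polarization.blockPairing (χ χ' : F →ₐ[ℚ] K) :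
    A.eigenspaceBaseChange K χ →ₗ[K] A.eigenspaceBaseChange K χ' →ₗ[K] K :=
  (Q.form.baseChange K).compl₁₂ (A.eigenspaceBaseChange K χ).subtype (A.eigenspaceBaseChange K χ').subtype

/-- `blockPairing x y = Q_K(x, y)`. [cite: Milne1999LefschetzClasses, §2 Remark 2.2 (p. 647)] -/
@[simp] theorem Polarization.blockPairing_apply (χ χ' : F →ₐ[ℚ] K) (x : A.eigenspaceBaseChange K χ)
    (y : A.eigenspaceBaseChange K χ') :
    Q.blockPairing K A χ χ' x y = Q.form.baseChange K (x : K ⊗[ℚ] V) (y : K ⊗[ℚ] V) :=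
  rfl

section Perfect

variable [Fintype S] [Module.Finite ℚ V] (κ : S → S)
variable (hτ : Injective τ) (hcard : Fintype.card S = finrank ℚ F)
  (hros : ∀ a v w, Q.form (A.ι a v) w = Q.form v (A.ι (σ a) w)) (hσ : ∀ a, σ (σ a) = a)
  (hκ : ∀ s, τ (κ s) = (τ s).comp (σ : F →ₐ[ℚ] F))

include hτ hcard hros hσ hκ in
/-- **`Q_K : V_{K,τₛ} × V_{K,τₛ∘σ} → K` is a perfect pairing** under the Rosati condition (the seat's FILE 2 of g21-#1, restated
for `blockPairing`). [cite: Milne1999LefschetzClasses, §2 Remark 2.2 (p. 647 L48 – p. 648 L7)] -/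
theorem Polarization.isPerfPair_blockPairing (s : S) :
    LinearMap.IsPerfPair (R := K) (M := A.eigenspaceBaseChange K (τ s))
      (N := A.eigenspaceBaseChange K ((τ s).comp (σ : F →ₐ[ℚ] F))) (Q.blockPairing K A (τ s) ((τ s).comp (σ : F →ₐ[ℚ] F))) :=
  Q.isPerfPair_baseChange_form_eigenspaceBaseChange K A τ σ κ hτ hcard hros hσ hκ s

include hτ hcard hros hσ hκ in
/-- **The block transpose `f ↦ fᵀ : End_K(V_{K,τₛ}) → End_K(V_{K,τₛ∘σ})`** across the perfect pairing `Q_K` (Milne's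
`α ↦ αᵗʳ` on `V₂ = V₁^∨`). [cite: Milne1999LefschetzClasses, §2 p. 650 L70–L74 ("V₂ = V₁^∨ … using the involution α ↦ αᵗʳ")] -/
def Polarization.blockTranspose (s : S) (f : A.BlockEnd K (τ s)) : A.BlockEnd K ((τ s).comp (σ : F →ₐ[ℚ] F)) :=
  pairingTranspose (R := K) (M := A.eigenspaceBaseChange K (τ s)) (N := A.eigenspaceBaseChange K ((τ s).comp (σ : F →ₐ[ℚ] F)))
    (Q.blockPairing K A (τ s) ((τ s).comp (σ : F →ₐ[ℚ] F))) (Q.isPerfPair_blockPairing K A τ σ κ hτ hcard hros hσ hκ s) f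

include hτ hcard hros hσ hκ in
/-- **`Q_K(x, fᵀ y) = Q_K(f x, y)`** for `x ∈ V_{K,τₛ}`, `y ∈ V_{K,τₛ∘σ}`. [cite: Milne1999LefschetzClasses, §2 p. 650 L74 ("φ₀(αx₁, x₂) = φ₀(x₁, αᵗʳx₂)")] -/
theorem Polarization.baseChange_form_apply_blockTranspose (s : S) (f : A.BlockEnd K (τ s)) (x : A.eigenspaceBaseChange K (τ s))
    (y : A.eigenspaceBaseChange K ((τ s).comp (σ : F →ₐ[ℚ] F))) :
    Q.form.baseChange K (x : K ⊗[ℚ] V) ((Q.blockTranspose K A τ σ κ hτ hcard hros hσ hκ s f y :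
        A.eigenspaceBaseChange K ((τ s).comp (σ : F →ₐ[ℚ] F))) : K ⊗[ℚ] V) =
      Q.form.baseChange K ((f x : A.eigenspaceBaseChange K (τ s)) : K ⊗[ℚ] V) (y : K ⊗[ℚ] V) :=
  apply_pairingTranspose (R := K) (M := A.eigenspaceBaseChange K (τ s))
    (N := A.eigenspaceBaseChange K ((τ s).comp (σ : F →ₐ[ℚ] F)))
    (Q.blockPairing K A (τ s) ((τ s).comp (σ : F →ₐ[ℚ] F))) (Q.isPerfPair_blockPairing K A τ σ κ hτ hcard hros hσ hκ s) f x y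

include hτ hcard hros hσ hκ in
/-- **Uniqueness of the block transpose**: `g = fᵀ` once `Q_K(x, g y) = Q_K(f x, y)` on the blocks.
[cite: Milne1999LefschetzClasses, §2 p. 650 L74] -/
theorem Polarization.blockTranspose_unique (s : S) {f : A.BlockEnd K (τ s)}
    {g : A.BlockEnd K ((τ s).comp (σ : F →ₐ[ℚ] F))}
    (h : ∀ (x : A.eigenspaceBaseChange K (τ s)) (y : A.eigenspaceBaseChange K ((τ s).comp (σ : F →ₐ[ℚ] F))),
      Q.form.baseChange K (x : K ⊗[ℚ] V) ((g y : A.eigenspaceBaseChange K ((τ s).comp (σ : F →ₐ[ℚ] F))) : K ⊗[ℚ] V) =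
        Q.form.baseChange K ((f x : A.eigenspaceBaseChange K (τ s)) : K ⊗[ℚ] V) (y : K ⊗[ℚ] V)) :
    g = Q.blockTranspose K A τ σ κ hτ hcard hros hσ hκ s f := by
  refine LinearMap.ext fun y =>
    (Q.isPerfPair_blockPairing K A τ σ κ hτ hcard hros hσ hκ s).bijective_right.injective (LinearMap.ext fun x => ?_)
  rw [LinearMap.flip_apply, LinearMap.flip_apply, Polarization.blockPairing_apply, Polarization.blockPairing_apply, h,
    Q.baseChange_form_apply_blockTranspose K A τ σ κ hτ hcard hros hσ hκ]

include hτ hcard hros hσ hκ in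
/-- `(f g)ᵀ = gᵀ fᵀ` on blocks. [cite: Milne1999LefschetzClasses, §2 p. 651 L5–L8] -/
theorem Polarization.blockTranspose_mul (s : S) (f g : A.BlockEnd K (τ s)) :
    Q.blockTranspose K A τ σ κ hτ hcard hros hσ hκ s (f * g) =
      Q.blockTranspose K A τ σ κ hτ hcard hros hσ hκ s g * Q.blockTranspose K A τ σ κ hτ hcard hros hσ hκ s f :=
  (Q.blockTranspose_unique K A τ σ κ hτ hcard hros hσ hκ s fun x y => by
    rw [Module.End.mul_apply, Q.baseChange_form_apply_blockTranspose K A τ σ κ hτ hcard hros hσ hκ,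
      Q.baseChange_form_apply_blockTranspose K A τ σ κ hτ hcard hros hσ hκ, Module.End.mul_apply]).symm

include hτ hcard hros hσ hκ in
/-- `1ᵀ = 1` on blocks. [cite: Milne1999LefschetzClasses, §2 p. 651 L5–L8] -/
theorem Polarization.blockTranspose_one (s : S) : Q.blockTranspose K A τ σ κ hτ hcard hros hσ hκ s 1 = 1 :=
  (Q.blockTranspose_unique K A τ σ κ hτ hcard hros hσ hκ s fun x y => by
    rw [Module.End.one_apply, Module.End.one_apply]).symm

include hτ hcard hros hσ hκ in
/-- The block transpose is injective. [cite: Milne1999LefschetzClasses, §2 p. 651 L5–L8] -/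
theorem Polarization.blockTranspose_injective (s : S) : Injective (Q.blockTranspose K A τ σ κ hτ hcard hros hσ hκ s) := by
  intro f g hfg
  refine LinearMap.ext fun x =>
    (Q.isPerfPair_blockPairing K A τ σ κ hτ hcard hros hσ hκ s).bijective_left.injective (LinearMap.ext fun y => ?_)
  rw [Polarization.blockPairing_apply, Polarization.blockPairing_apply,
    ← Q.baseChange_form_apply_blockTranspose K A τ σ κ hτ hcard hros hσ hκ, hfg,
    Q.baseChange_form_apply_blockTranspose K A τ σ κ hτ hcard hros hσ hκ]

end Perfect

/-- An operator commuting with every `a_K`, `a ∈ E_φ`, preserves each block `V_{K,χ}` (it commutes with `ι(F)_K ⊆ E_φ ⊗ K`).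
[cite: Milne1999LefschetzClasses, §2 p. 646 L50–L52 ("any k-linear map α commuting with the action of F decomposes into α = α₁ ⊕ ⋯ ⊕ α_t")] -/
theorem EndAction.apply_mem_eigenspaceBaseChange_of_forall_comm {c : Module.End K (K ⊗[ℚ] V)}
    (hc : ∀ a : H.endAlg, (a : Module.End ℚ V).baseChange K * c = c * (a : Module.End ℚ V).baseChange K)
    {χ : F →ₐ[ℚ] K} {x : K ⊗[ℚ] V} (hx : x ∈ A.eigenspaceBaseChange K χ) : c x ∈ A.eigenspaceBaseChange K χ :=
  A.apply_mem_eigenspaceBaseChange_of_comm K (γ := c)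
    (fun f y => by rw [← Module.End.mul_apply, ← hc ⟨A.ι f, A.map_F_le f⟩, Module.End.mul_apply]) hx

/-- **The block `c|V_{K,χ}`** of an operator `c` commuting with `E_φ ⊗ K` (Milne's `αᵢ` in `α = α₁ ⊕ ⋯ ⊕ α_t`).
[cite: Milne1999LefschetzClasses, §2 p. 646 L50–L52] -/
def EndAction.restrictBlock (c : Module.End K (K ⊗[ℚ] V))
    (hc : ∀ a : H.endAlg, (a : Module.End ℚ V).baseChange K * c = c * (a : Module.End ℚ V).baseChange K)
    (χ : F →ₐ[ℚ] K) : A.BlockEnd K χ :=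
  c.restrict fun _ hx => A.apply_mem_eigenspaceBaseChange_of_forall_comm K hc hx

/-- `(c|V_{K,χ}) x = c x`. [cite: Milne1999LefschetzClasses, §2 p. 646 L50–L52] -/
@[simp] theorem EndAction.coe_restrictBlock_apply (c : Module.End K (K ⊗[ℚ] V))
    (hc : ∀ a : H.endAlg, (a : Module.End ℚ V).baseChange K * c = c * (a : Module.End ℚ V).baseChange K)
    (χ : F →ₐ[ℚ] K) (x : A.eigenspaceBaseChange K χ) :
    ((A.restrictBlock K c hc χ x : A.eigenspaceBaseChange K χ) : K ⊗[ℚ] V) = c x :=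
  rfl

/-- The block of `c` commutes with the restricted operators: `c|V_{K,χ} ∈ C_χ` (the commutant of `E_φ|V_{K,χ}`), for `ι(F)`
central. [cite: Milne1999LefschetzClasses, §2 p. 651 L64–L70 ("C(A) ⊗_k k^al = ∏ C_σ")] -/
theorem EndAction.restrictBlock_mem_centralizer_blockOp (hcent : ∀ a ∈ H.endAlg, ∀ f : F, a * A.ι f = A.ι f * a)
    {c : Module.End K (K ⊗[ℚ] V)}
    (hc : ∀ a : H.endAlg, (a : Module.End ℚ V).baseChange K * c = c * (a : Module.End ℚ V).baseChange K) (χ : F →ₐ[ℚ] K) :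
    A.restrictBlock K c hc χ ∈ Subalgebra.centralizer K (Set.range (A.blockOp K hcent χ)) := by
  rw [Subalgebra.mem_centralizer_iff]
  rintro _ ⟨a, rfl⟩
  refine LinearMap.ext fun x => Subtype.ext ?_
  change (a : Module.End ℚ V).baseChange K (c (x : K ⊗[ℚ] V)) = c ((a : Module.End ℚ V).baseChange K (x : K ⊗[ℚ] V))
  rw [← Module.End.mul_apply, hc a, Module.End.mul_apply]

/-! ## §2 `†` transposes the blocks: `c†|V_{K,τₛ∘σ} = (c|V_{K,τₛ})ᵀ` ("`(α, β)† = (βᵗʳ, αᵗʳ)`") -/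

section Involution

variable [Fintype S] [Module.Finite ℚ V] (κ : S → S)
variable (hτ : Injective τ) (hcard : Fintype.card S = finrank ℚ F)
  (hros : ∀ a v w, Q.form (A.ι a v) w = Q.form v (A.ι (σ a) w)) (hσ : ∀ a, σ (σ a) = a)
  (hκ : ∀ s, τ (κ s) = (τ s).comp (σ : F →ₐ[ℚ] F))

include hτ hcard hros hσ hκ in
/-- **`c†|V_{K,τₛ∘σ} = (c|V_{K,τₛ})ᵀ`**: for an operator `c` commuting with `E_φ ⊗ K` (so that `c†` does too, `E_φ† = E_φ`),
the block of `c†` on the partner block is the transpose of the block of `c` across the perfect pairing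
`Q_K : V_{K,τₛ} × V_{K,τₛ∘σ} → K` — Milne's "`(α, β)† = (βᵗʳ, αᵗʳ)`" on `V̄ = V₁ ⊕ V₁^∨` (type IV), "the involution sends an
element of `Cᵢ` to its adjoint with respect to `φᵢ`" (type I, `σ`-fixed embeddings).
[cite: Milne1999LefschetzClasses, §2 p. 651 L5–L8 ("(α, β)† = (βᵗʳ, αᵗʳ)") and p. 648 L50–L52] -/
theorem Polarization.restrictBlock_adjointBaseChange_eq_blockTranspose {c : Module.End K (K ⊗[ℚ] V)}
    (hc : ∀ a : H.endAlg, (a : Module.End ℚ V).baseChange K * c = c * (a : Module.End ℚ V).baseChange K) (s : S) :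
    A.restrictBlock K (Q.adjointBaseChange K c) (Q.forall_baseChange_comp_adjointBaseChange_of_forall_comm K hc)
        ((τ s).comp (σ : F →ₐ[ℚ] F)) =
      Q.blockTranspose K A τ σ κ hτ hcard hros hσ hκ s (A.restrictBlock K c hc (τ s)) :=
  Q.blockTranspose_unique K A τ σ κ hτ hcard hros hσ hκ s fun x y => by
    rw [EndAction.coe_restrictBlock_apply, EndAction.coe_restrictBlock_apply, Q.baseChange_form_apply_adjointBaseChange K]

include hτ hcard hros hσ hκ in
/-- **`(a_K|V_{K,τₛ})ᵀ = (a†)_K|V_{K,τₛ∘σ}`** for `a ∈ E_φ` (`a† ∈ E_φ`): the restricted operators of the two blocks of a pair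
are swapped by transposition ("`V₂ = V₁^∨` … turned into a left module structure by using the involution `α ↦ αᵗʳ`").
[cite: Milne1999LefschetzClasses, §2 p. 650 L70–L74 and §1 p. 642 L64–L70] -/
theorem EndAction.blockTranspose_blockOp (hcent : ∀ a ∈ H.endAlg, ∀ f : F, a * A.ι f = A.ι f * a) (a : H.endAlg) (s : S) :
    Q.blockTranspose K A τ σ κ hτ hcard hros hσ hκ s (A.blockOp K hcent (τ s) a) =
      A.blockOp K hcent ((τ s).comp (σ : F →ₐ[ℚ] F)) ⟨Q.adjoint (a : Module.End ℚ V), Q.adjoint_mem_endAlg a.2⟩ :=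
  (Q.blockTranspose_unique K A τ σ κ hτ hcard hros hσ hκ s fun x y => by
    rw [EndAction.coe_blockOp_apply, EndAction.coe_blockOp_apply, ← Q.adjointBaseChange_baseChange K,
      Q.baseChange_form_apply_adjointBaseChange K]).symm

include hτ hcard hros hσ hκ in
/-- **`†` maps `C_{τₛ}` into `C_{τₛ∘σ}`**: if `f ∈ End_K(V_{K,τₛ})` commutes with every `a_K|V_{K,τₛ}`, `a ∈ E_φ`, then `fᵀ`
commutes with every `a_K|V_{K,τₛ∘σ}` (write `a_K|V_{K,τₛ∘σ} = ((a†)_K|V_{K,τₛ})ᵀ` and use anti-multiplicativity) — the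
involution identifies Milne's `C_σ₁` and `C_σ₂` (anti-isomorphically; the commutants are the `EndAction.blockCommutant` of the
lane's `Motives/HodgeStructureEndAlgCentralizerBlocks`, unfolded). [cite: Milne1999LefschetzClasses, §2 p. 651 L5–L8 and L64–L70 ("C_σ ≈ End_Ē(V̄) ≈ M × M")] -/
theorem EndAction.blockTranspose_mem_centralizer_blockOp (hcent : ∀ a ∈ H.endAlg, ∀ f : F, a * A.ι f = A.ι f * a) (s : S)
    {f : A.BlockEnd K (τ s)} (hf : f ∈ Subalgebra.centralizer K (Set.range (A.blockOp K hcent (τ s)))) :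
    Q.blockTranspose K A τ σ κ hτ hcard hros hσ hκ s f ∈
      Subalgebra.centralizer K (Set.range (A.blockOp K hcent ((τ s).comp (σ : F →ₐ[ℚ] F)))) := by
  rw [Subalgebra.mem_centralizer_iff] at hf ⊢
  rintro _ ⟨a, rfl⟩
  set b : H.endAlg := ⟨Q.adjoint (a : Module.End ℚ V), Q.adjoint_mem_endAlg a.2⟩ with hb
  have hab : a = ⟨Q.adjoint (b : Module.End ℚ V), Q.adjoint_mem_endAlg b.2⟩ :=
    Subtype.ext (by rw [hb]; exact (Polarization.adjoint_adjoint Q (a : Module.End ℚ V)).symm)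
  rw [hab, ← A.blockTranspose_blockOp K τ Q σ κ hτ hcard hros hσ hκ hcent b s, ← Q.blockTranspose_mul K A τ σ κ hτ hcard hros hσ hκ,
    ← Q.blockTranspose_mul K A τ σ κ hτ hcard hros hσ hκ, hf _ ⟨b, rfl⟩]

include hτ hcard hros hσ hκ in
/-- **The blocks of `c†` for `c ∈ C(H)(K)`, assembled**: for every `s`, `c†|V_{K,τₛ∘σ} = (c|V_{K,τₛ})ᵀ` and both blocks lie in
the respective commutants — "`C(A)` is a `k`-algebra stable under the involution `†`", read on `∏_σ C_σ`.
[cite: Milne1999LefschetzClasses, §1 p. 643 L5–L6 and §2 p. 651 L5–L8] -/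
theorem Polarization.restrictBlock_adjointBaseChange_mem_and_eq (hcent : ∀ a ∈ H.endAlg, ∀ f : F, a * A.ι f = A.ι f * a)
    {c : Module.End K (K ⊗[ℚ] V)}
    (hc : ∀ a : H.endAlg, (a : Module.End ℚ V).baseChange K * c = c * (a : Module.End ℚ V).baseChange K) (s : S) :
    A.restrictBlock K (Q.adjointBaseChange K c) (Q.forall_baseChange_comp_adjointBaseChange_of_forall_comm K hc)
          ((τ s).comp (σ : F →ₐ[ℚ] F)) ∈
        Subalgebra.centralizer K (Set.range (A.blockOp K hcent ((τ s).comp (σ : F →ₐ[ℚ] F)))) ∧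
      A.restrictBlock K (Q.adjointBaseChange K c) (Q.forall_baseChange_comp_adjointBaseChange_of_forall_comm K hc)
          ((τ s).comp (σ : F →ₐ[ℚ] F)) =
        Q.blockTranspose K A τ σ κ hτ hcard hros hσ hκ s (A.restrictBlock K c hc (τ s)) :=
  ⟨A.restrictBlock_mem_centralizer_blockOp K hcent _ _,
    Q.restrictBlock_adjointBaseChange_eq_blockTranspose K A τ σ κ hτ hcard hros hσ hκ hc s⟩

end Involution

end HodgeStructure

end Literature.AlgebraicGeometry.Motives
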